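import Summits.QuantumFields.YangMills.Theorems.LuscherReductionTwistedTraceScalingBOStiffTailFP
import Summits.QuantumFields.YangMills.Theorems.LuscherReductionRunningReductionLatticeLinkKernel
import HarnessLib

/-!
# (B-ST) step (B), the shell tail door: a test function living where the magnetic action is `≥ s` has transfer form `≤ e^{2β|E|}·e^{−βs}·‖f‖²`, and so does its based average
# (lane A of S-BASE, crux `TwistedTraceScaling` stmt-QuantumFields-20203, C4-CORE, the (B-ST) pen; design card `pub/ym-fleet/ym-luscher-20007-p1/Lines-BST-poincare.md` (B); HANDOFF-g21 (S6))

The STIFF SHELL part `v_sh` of a test function (fibre coordinate outside the profile ball of record) has no orthogonality constraint; it is small because the Wilson action is large there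
(`…BOShellCoercive.shell_exponent_ge_of_hodge`: `βS ≥ c·g₀·ℓ²` pointwise on the shell) and the kernel carries `e^{−(β/2)(S(U)+S(V))}`:
* ★ `transferKernel_le_expCard_mul_exp_action` — `K_β(U,V) ≤ (e^{2β})^{|E|}·e^{−(β/2)S(U)}·e^{−(β/2)S(V)}`;
* ★★ `qform_le_of_action_ge` — if `S ≥ s` on the support of a bounded measurable `f`, then `⟨f, K_βf⟩ ≤ (e^{2β})^{|E|}·e^{−βs}·‖f‖²` (probability space);
* ★★ `qform_basedAvg_le_of_action_ge` — the same for the BASED AVERAGE `P₀f` of an `f` supported in `{S ≥ s} ∩ supp χ`, in the weight of record: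
  `⟨P₀f, K_βP₀f⟩ ≤ (e^{2β})^{|E|}·e^{−βs}·∫ f²·(P₀χ/χ)` (gauge invariance of `S` + `…BOStiffTailFP.l2_basedAvg_indicator_le` at `A = univ`, `κ = 1`); with `…BOStiffColour.tubeForm_le_qform_basedIntegral`
  this bounds the shell contribution to the tube form, to be beaten by the ABSOLUTE currency floor (`…BOCurrencyFloor`).
HONEST FRAMING: bookkeeping for a stub of a child of the CONDITIONAL route R2b1; (B-ST) OPEN; C4-CORE OPEN; not infinite volume, not a gap, not Clay.
-/

set_option autoImplicit false

noncomputable section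

open MeasureTheory Filter Topology Real
open scoped BigOperators
open Literature.MathematicalPhysics.QuantumFieldTheory
open Literature.MathematicalPhysics.QuantumLattice

namespace Summit.QuantumFields.YangMills.Theorems.FemtoTransferGap.TwoLattice.ConstTube

open Summit.QuantumFields.YangMills.Theorems.FemtoTransferGap
open Summit.QuantumFields.YangMills.Theorems.FemtoTransferGap.TwoLattice.Avg

variable {L : ℕ} [NeZero L]

/-- ★ `K_β(U,V) ≤ (e^{2β})^{|E|}·e^{−(β/2)S(U)}·e^{−(β/2)S(V)}` (`β ≥ 0`). [cite: SeilerLNP1982, §3] -/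
theorem transferKernel_le_expCard_mul_exp_action {β : ℝ} (hβ : 0 ≤ β) (U V : GaugeConfig 3 L SU2) :
    transferKernel su2Rep β U V ≤ Real.exp (2 * β) ^ Fintype.card (Edge 3 L) * (Real.exp (-(β / 2) * wilsonAction su2Rep U) * Real.exp (-(β / 2) * wilsonAction su2Rep V)) := by
  rw [transferKernel_eq_latE_mul, ← Real.exp_add]
  have e : -(β / 2) * (wilsonAction su2Rep U + wilsonAction su2Rep V) = -(β / 2) * wilsonAction su2Rep U + -(β / 2) * wilsonAction su2Rep V := by ring
  rw [e]
  exact mul_le_mul_of_nonneg_right (latE_le hβ U V) (Real.exp_pos _).le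

/-- ★★ **Transfer form of a function living where the action is large**: if `s ≤ S(U)` whenever `f U ≠ 0` (`β ≥ 0`, `f` bounded measurable), then
`⟨f, K_βf⟩ ≤ (e^{2β})^{|E|}·e^{−βs}·‖f‖²`. [cite: SeilerLNP1982, §3] -/
theorem qform_le_of_action_ge {β : ℝ} (hβ : 0 ≤ β) {f : GaugeConfig 3 L SU2 → ℝ} (hf : Measurable f) {Cf : ℝ} (hCf : ∀ U, |f U| ≤ Cf) {s : ℝ}
    (hs : ∀ U, f U ≠ 0 → s ≤ wilsonAction su2Rep U) :
    qform su2Rep β f f ≤ Real.exp (2 * β) ^ Fintype.card (Edge 3 L) * Real.exp (-(β * s)) * l2 f f := by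
  haveI : SecondCountableTopology SU2 := secondCountableTopology_su2
  set EK : ℝ := Real.exp (2 * β) ^ Fintype.card (Edge 3 L) with hEK
  have hEK0 : 0 ≤ EK := by positivity
  have hCf0 : 0 ≤ Cf := (abs_nonneg _).trans (hCf 1)
  -- `g := |f|·e^{−(β/2)S} ≤ e^{−βs/2}|f|` pointwise
  have hSm : Measurable fun U : GaugeConfig 3 L SU2 => Real.exp (-(β / 2) * wilsonAction su2Rep U) :=
    (Real.continuous_exp.comp (continuous_const.mul (continuous_wilsonAction su2Rep continuous_su2Rep))).measurable
  have hS1 : ∀ U : GaugeConfig 3 L SU2, Real.exp (-(β / 2) * wilsonAction su2Rep U) ≤ 1 := fun U =>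
    Real.exp_le_one_iff.2 (by have := wilsonAction_su2_nonneg_lat U; nlinarith)
  have hg : ∀ U, |f U| * Real.exp (-(β / 2) * wilsonAction su2Rep U) ≤ Real.exp (-(β * s / 2)) * |f U| := fun U => by
    by_cases h : f U = 0
    · rw [h, abs_zero, zero_mul, mul_zero]
    · rw [mul_comm]
      exact mul_le_mul_of_nonneg_right (Real.exp_le_exp.2 (by have := hs U h; nlinarith)) (abs_nonneg _)
  have hfa : Measurable fun U => |f U| := hf.abs
  -- `∫∫ fKf ≤ EK·(∫|f|e^{−βS/2})² ≤ EK·e^{−βs}(∫|f|)² ≤ EK·e^{−βs}·∫f²`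
  set g : GaugeConfig 3 L SU2 → ℝ := fun U => |f U| * Real.exp (-(β / 2) * wilsonAction su2Rep U) with hgdef
  have hgm : Measurable g := hfa.mul hSm
  have hgb : ∀ U, |g U| ≤ Cf := fun U => by
    simp only [hgdef]; rw [abs_mul, abs_abs, abs_of_pos (Real.exp_pos _)]; exact (mul_le_of_le_one_right (abs_nonneg _) (hS1 U)).trans (hCf U)
  have hg0 : ∀ U, 0 ≤ g U := fun U => mul_nonneg (abs_nonneg _) (Real.exp_pos _).le
  have h1 : qform su2Rep β f f ≤ EK * (∫ U, g U ∂configMeasure SU2 L) ^ 2 := by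
    rw [qform_eq_integral_prod_bdd β hf hCf hf hCf]
    have hm : Measurable (Function.uncurry fun U V : GaugeConfig 3 L SU2 => EK * (g U * g V)) := ((hgm.comp measurable_fst).mul (hgm.comp measurable_snd)).const_mul EK
    have hb : ∀ U V : GaugeConfig 3 L SU2, |EK * (g U * g V)| ≤ EK * (Cf * Cf) := fun U V => by
      rw [abs_mul, abs_of_nonneg hEK0, abs_mul]
      exact mul_le_mul_of_nonneg_left (mul_le_mul (hgb U) (hgb V) (abs_nonneg _) hCf0) hEK0
    have h := integral_mono (integrable_qform_integrand β hf hCf hf hCf) (StiffDoor.integrable_prod_of_bdd (μ := configMeasure SU2 L) hm hb) fun p => by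
      dsimp only [Function.uncurry]
      have hK := transferKernel_le_expCard_mul_exp_action hβ p.1 p.2
      have hK0 := transferKernel_pos su2Rep β p.1 p.2
      calc f p.1 * transferKernel su2Rep β p.1 p.2 * f p.2 ≤ |f p.1 * transferKernel su2Rep β p.1 p.2 * f p.2| := le_abs_self _
        _ = |f p.1| * transferKernel su2Rep β p.1 p.2 * |f p.2| := by rw [abs_mul, abs_mul, abs_of_pos hK0]
        _ ≤ |f p.1| * (EK * (Real.exp (-(β / 2) * wilsonAction su2Rep p.1) * Real.exp (-(β / 2) * wilsonAction su2Rep p.2))) * |f p.2| :=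
            mul_le_mul_of_nonneg_right (mul_le_mul_of_nonneg_left hK (abs_nonneg _)) (abs_nonneg _)
        _ = EK * (g p.1 * g p.2) := by simp only [hgdef]; ring
    refine h.trans (le_of_eq ?_)
    show ∫ p, EK * (g p.1 * g p.2) ∂(configMeasure SU2 L).prod (configMeasure SU2 L) = _
    rw [← StiffDoor.integral_integral_eq_prod (μ := configMeasure SU2 L) hm hb]
    simp_rw [integral_const_mul]
    rw [integral_mul_const, sq]
  have h2 : ∫ U, g U ∂configMeasure SU2 L ≤ Real.exp (-(β * s / 2)) * ∫ U, |f U| ∂configMeasure SU2 L := by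
    rw [← integral_const_mul]
    exact integral_mono (integrable_of_measurable_abs_le _ hgm hgb) ((integrable_of_measurable_abs_le _ hfa (C := Cf) fun U => by rw [abs_abs]; exact hCf U).const_mul _) hg
  have h0 : 0 ≤ ∫ U, g U ∂configMeasure SU2 L := integral_nonneg hg0
  have h3 : (∫ U, |f U| ∂configMeasure SU2 L) ^ 2 ≤ l2 f f := by
    have h := sq_integral_mul_le (configMeasure SU2 L) hfa measurable_const (Cw := 1) (fun U => by rw [abs_abs]; exact hCf U) (fun _ => by norm_num) (fun _ => zero_le_one)
    simp only [mul_one, integral_const, probReal_univ, smul_eq_mul, sq_abs] at h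
    unfold l2
    refine h.trans (le_of_eq (integral_congr_ae (ae_of_all _ fun U => by ring)))
  have hee : Real.exp (-(β * s / 2)) ^ 2 = Real.exp (-(β * s)) := by rw [← Real.exp_nat_mul]; congr 1; ring
  calc qform su2Rep β f f ≤ EK * (∫ U, g U ∂configMeasure SU2 L) ^ 2 := h1
    _ ≤ EK * (Real.exp (-(β * s / 2)) * ∫ U, |f U| ∂configMeasure SU2 L) ^ 2 := mul_le_mul_of_nonneg_left (pow_le_pow_left₀ h0 h2 2) hEK0
    _ = EK * Real.exp (-(β * s)) * (∫ U, |f U| ∂configMeasure SU2 L) ^ 2 := by rw [mul_pow, hee]; ring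
    _ ≤ EK * Real.exp (-(β * s)) * l2 f f := mul_le_mul_of_nonneg_left h3 (mul_nonneg hEK0 (Real.exp_pos _).le)

/-- ★★ **The based average of a shell function**: if `f` is bounded measurable, vanishes off `supp χ` and off `{S ≥ s}` (`χ ≥ 0` bounded measurable, `χ ≥ c > 0` on its support), then
`⟨P₀f, K_βP₀f⟩ ≤ (e^{2β})^{|E|}·e^{−βs}·∫ f²·(P₀χ/χ)` — the Wilson action is gauge invariant, so `P₀f` still lives on `{S ≥ s}`, and `‖P₀f‖² ≤ ∫ f²(P₀χ/χ)`. [cite: SeilerLNP1982, §3] -/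
theorem qform_basedAvg_le_of_action_ge {β : ℝ} (hβ : 0 ≤ β) {f χ : GaugeConfig 3 L SU2 → ℝ} (hf : Measurable f) {Cf : ℝ} (hCf : ∀ U, |f U| ≤ Cf) (hχ : Measurable χ)
    {Cχ : ℝ} (hCχ : ∀ U, |χ U| ≤ Cχ) (hχ0 : ∀ U, 0 ≤ χ U) {c : ℝ} (hc : 0 < c) (hcχ : ∀ U, χ U ≠ 0 → c ≤ χ U) (hsupp : ∀ U, χ U = 0 → f U = 0) {s : ℝ}
    (hs : ∀ U, f U ≠ 0 → s ≤ wilsonAction su2Rep U) :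
    qform su2Rep β (fun U => ∫ h, f (gaugeTransform (basedExt L h) U) ∂basedMeasure L) (fun U => ∫ h, f (gaugeTransform (basedExt L h) U) ∂basedMeasure L) ≤
      Real.exp (2 * β) ^ Fintype.card (Edge 3 L) * Real.exp (-(β * s)) * ∫ U, f U ^ 2 * ((∫ h, χ (gaugeTransform (basedExt L h) U) ∂basedMeasure L) / χ U) ∂configMeasure SU2 L := by
  obtain ⟨hPm, hPb⟩ := basedIntegral_props (L := L) hf hCf
  -- `P₀f` lives on `{S ≥ s}` (gauge invariance of the action)
  have hsP : ∀ U, (∫ h, f (gaugeTransform (basedExt L h) U) ∂basedMeasure L) ≠ 0 → s ≤ wilsonAction su2Rep U := fun U hU => by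
    by_contra hlt
    apply hU
    refine integral_eq_zero_of_ae (ae_of_all _ fun h => ?_)
    by_contra hne
    exact hlt (by have := hs _ hne; rwa [wilsonAction_gaugeTransform] at this)
  have h1 := qform_le_of_action_ge hβ hPm hPb hsP
  have h2 : l2 (fun U => ∫ h, f (gaugeTransform (basedExt L h) U) ∂basedMeasure L) (fun U => ∫ h, f (gaugeTransform (basedExt L h) U) ∂basedMeasure L) ≤
      ∫ U, f U ^ 2 * ((∫ h, χ (gaugeTransform (basedExt L h) U) ∂basedMeasure L) / χ U) ∂configMeasure SU2 L := by
    have h := l2_basedAvg_indicator_le (L := L) hf hCf hχ hCχ hχ0 hc hcχ hsupp MeasurableSet.univ (κ := 1) (fun U => by simp)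
    simp only [Set.indicator_univ, one_mul] at h
    unfold l2
    refine le_trans (le_of_eq (integral_congr_ae (ae_of_all _ fun U => by ring))) h
  exact h1.trans (mul_le_mul_of_nonneg_left h2 (by positivity))

end Summit.QuantumFields.YangMills.Theorems.FemtoTransferGap.TwoLattice.ConstTube

end
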